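import Mathlib
import HarnessLib

/-!
# Properness `M ≠ ⊤` is load-bearing in the crux `DegreeOnePrimesEscape` (the variant without it is false)

Topic `Literature/Barriers/QuantumAdvantage`. Negative knowledge about the route crux
`Summit.QuantumAdvantage.QuantumAdvantage.Theses.LinnikCubicClassGroups.DegreeOnePrimesEscape`
(route `LinnikCubicClassGroups`, item `stmt-QuantumAdvantage-11543`): delete its properness
hypothesis `M ≠ ⊤` and the statement is FALSE, already at `n = 1`, `K = ℚ`, `x = 2`, `M = ⊤`
(nothing lies outside `⊤`, while `π(2) = 1`). History: the hypothesis-free proposition was written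
inline in a `Summits/` disproof work file, relocated by the gate at accept time to
`Literature/Uncategorized/DegreeOnePrimesEscapeWithoutProper.lean` (p69749) as a `def … : Prop`,
refuted there (p70385), retired from the named-fact ledger (verdict clean-up 2026-08-16, action
retire-refuted), and moved by the librarian (2026-08-16) to this directory; the old module is now a
deprecated alias shim onto this one.

## Contents

* `DegreeOnePrimesEscapeWithoutProper_false` — THE refuting theorem (accepted p70385; never to be
  deleted): `¬ ∀ n, ∃ C, ∀ K … ∀ M, π(x) ≤ 8 · #{P : N(P) prime, N(P) ≤ x, [P] ∉ M}`, the negand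
  written out explicitly so that the theorem does not depend on the tombstone name below;
  `not_degreeOnePrimesEscapeWithoutProper` is its `not_<decl>` alias.
* `DegreeOnePrimesEscapeWithoutProper` — **REFUTED; retired tombstone, `@[deprecated]`** (verdict
  clean-up 2026-08-16, second pass after the move). Its body is, verbatim, the negand of
  `DegreeOnePrimesEscapeWithoutProper_false` (machine-checked by
  `DegreeOnePrimesEscapeWithoutProper_iff_false`, which is `iff_false_intro` of that theorem and is
  deprecated together with the name). It is not a published statement (no source), it can have no
  discharge `_holds`, and it must never be taken as a hypothesis (that hypothesis proves `False`).
  No corrected restatement is vendored in `Literature`: the corrected form — the crux WITH `M ≠ ⊤` —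
  is the open route obligation itself and lives under `Summits/`.

## Why the tombstone is deprecated rather than deleted, and how to delete it

The name still has importers, all through the deprecated shim
`Literature/Uncategorized/DegreeOnePrimesEscapeWithoutProper.lean`
(`abbrev Literature.Uncategorized.DegreeOnePrimesEscapeWithoutProper := <this def>`):
`Summits/QuantumAdvantage/QuantumAdvantage/Theorems/DegreeOnePrimesEscape/Negative/WithoutProperFalse.lean`
(theorem `degreeOnePrimesEscape_false_without_proper : ¬ Literature.Uncategorized.DegreeOnePrimesEscapeWithoutProper`,
its own proof) and the three work files `Summits/QuantumAdvantage/QuantumAdvantage/Cruxes/DegreeOnePrimesEscape/`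
`{Disproof.lean, Lines/reserve-primes-absorption.lean, Lines/dedekind-s3-collision.lean}` (one
`example : ¬ Literature.Uncategorized.DegreeOnePrimesEscapeWithoutProper := …` each). Deleting the
`def` now would break them, and `Literature` may not edit `Summits`. Deletion recipe (no statement is
lost, nothing here needs restating): (1) Summits side — replace those four references by
`Literature.Barriers.QuantumAdvantage.DegreeOnePrimesEscapeWithoutProper_false` (same statement,
explicit negand) or drop them; (2) delete the shim module `Literature/Uncategorized/…WithoutProper.lean`;
(3) delete `DegreeOnePrimesEscapeWithoutProper` and `DegreeOnePrimesEscapeWithoutProper_iff_false`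
below. `DegreeOnePrimesEscapeWithoutProper_false` and `not_degreeOnePrimesEscapeWithoutProper` stay.
-/

namespace Literature.Barriers.QuantumAdvantage

open scoped NumberField nonZeroDivisors

/-- **The crux `DegreeOnePrimesEscape` without its properness hypothesis is false** (`M ≠ ⊤` is
load-bearing in route `LinnikCubicClassGroups`, item `stmt-QuantumAdvantage-11543`). The negand is
that crux with `M ≠ ⊤` deleted, otherwise verbatim: for every degree `n` there is an exponent `C`
such that for every number field `K` of degree `n` with no quadratic subfield, every
`x ≥ |d_K| ^ C` and EVERY subgroup `M` of the class group,
`π(x) ≤ 8 · #{P prime of 𝓞 K : N(P) prime, N(P) ≤ x, [P] ∉ M}`. Witness: `n = 1`, `K = ℚ` (no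
intermediate field of degree `2`; `|d_ℚ| ^ C = 1 ≤ 2` for every `C`), `x = 2`, `M = ⊤`: no prime
class lies outside `⊤`, the counted set is empty, and the inequality reads `π(2) = 1 ≤ 8 · 0`.
Same argument as the summit-side
`Summit.QuantumAdvantage.QuantumAdvantage.Theorems.DegreeOnePrimesEscape.Negative.degreeOnePrimesEscape_false_without_proper`,
re-proved here because `Literature` does not import `Summits`. THE refuting theorem of the retired
tombstone `DegreeOnePrimesEscapeWithoutProper` below (accepted p70385): never delete it.
- technique_class: escape counting against an ARBITRARY subgroup `M ≤ Cl(K)` (the improper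
  subgroup `M = ⊤` allowed) — i.e. any strengthening of `DegreeOnePrimesEscape` that drops `M ≠ ⊤`
- blocks: stating or using the crux `DegreeOnePrimesEscape` (or a Chebotarev/Linnik-type lower
  bound for prime ideals outside a subgroup of the class group) without the hypothesis `M ≠ ⊤`
- because: for `M = ⊤` the counted set `{P : [P] ∉ M}` is empty while `π(x) ≥ 1` for `x ≥ 2`;
  already `K = ℚ`, `x = 2` is a counterexample for every exponent `C` [folklore]
- evasions_known: keep `M ≠ ⊤` (the crux as filed in `Theses/LinnikCubicClassGroups.lean`) [folklore]
- scope_caveats: says nothing about the crux WITH `M ≠ ⊤` (open route obligation under `Summits/`);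
  elementary negative knowledge about a route statement, not a published no-go result
- status: established (this theorem)
[folklore] -/
theorem DegreeOnePrimesEscapeWithoutProper_false :
    ¬ ∀ n : ℕ, ∃ C : ℕ, ∀ (K : Type) [Field K] [NumberField K], Module.finrank ℚ K = n →
      (∀ F : IntermediateField ℚ K, Module.finrank ℚ F ≠ 2) → ∀ x : ℕ,
        |NumberField.discr K| ^ C ≤ (x : ℤ) → ∀ M : Subgroup (ClassGroup (𝓞 K)),
          Nat.primeCounting x ≤ 8 * Set.ncard {P : Ideal (𝓞 K) | P.IsPrime ∧ (Ideal.absNorm P).Prime ∧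
            Ideal.absNorm P ≤ x ∧ ∃ hP : P ∈ nonZeroDivisors (Ideal (𝓞 K)), ClassGroup.mk0 ⟨P, hP⟩ ∉ M} := by
  intro h
  obtain ⟨C, hC⟩ := h 1
  have hq : ∀ F : IntermediateField ℚ ℚ, Module.finrank ℚ F ≠ 2 := by
    intro F hF
    have h := F.toSubalgebra.toSubmodule.finrank_le
    simp only [Module.finrank_self] at h
    have h' : Module.finrank ℚ F ≤ 1 := h
    omega
  have key := hC ℚ (Module.finrank_self ℚ) hq 2 (by rw [NumberField.discr_rat]; simp) ⊤
  have hempty : {P : Ideal (𝓞 ℚ) | P.IsPrime ∧ (Ideal.absNorm P).Prime ∧ Ideal.absNorm P ≤ 2 ∧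
      ∃ hP : P ∈ nonZeroDivisors (Ideal (𝓞 ℚ)), ClassGroup.mk0 ⟨P, hP⟩ ∉ (⊤ : Subgroup _)} = ∅ := by
    ext P
    simp
  have h2 : Nat.primeCounting 2 = 1 := by decide
  rw [hempty, Set.ncard_empty, h2] at key
  omega

/-- `not_<decl>` spelling of `DegreeOnePrimesEscapeWithoutProper_false`: the refutation of record of
the retired named fact `DegreeOnePrimesEscapeWithoutProper` (same statement, explicit negand).
[folklore] -/
alias not_degreeOnePrimesEscapeWithoutProper := DegreeOnePrimesEscapeWithoutProper_false

/-- **REFUTED — retired tombstone (named-fact verdict clean-up 2026-08-16, action retire-refuted);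
deprecated; never take `(h : DegreeOnePrimesEscapeWithoutProper)` as a hypothesis (it proves `False`:
`DegreeOnePrimesEscapeWithoutProper_iff_false`).** The crux `DegreeOnePrimesEscape` of route
`LinnikCubicClassGroups` (`Summit.QuantumAdvantage.QuantumAdvantage.Theses.LinnikCubicClassGroups.DegreeOnePrimesEscape`,
item `stmt-QuantumAdvantage-11543`) with the properness hypothesis `M ≠ ⊤` dropped, otherwise
verbatim; the body is, character for character, the negand of the refuting theorem
`DegreeOnePrimesEscapeWithoutProper_false` above (witness `n = 1`, `K = ℚ`, `x = 2`, `M = ⊤`), so no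
discharge `_holds` can exist and the proposition is retired from the named-fact ledger. It is not a
published statement (no source); its only correct form — the crux WITH `M ≠ ⊤` — is an open route
obligation under `Summits/`, deliberately not restated in `Literature`. The name survives, deprecated,
solely because `Summits/` modules still reach it through the deprecated shim
`Literature.Uncategorized.DegreeOnePrimesEscapeWithoutProper` (list and deletion recipe in the module
docstring); delete it, together with `DegreeOnePrimesEscapeWithoutProper_iff_false`, once no module
names it. [folklore] -/
@[deprecated DegreeOnePrimesEscapeWithoutProper_false "REFUTED: `Literature.Barriers.QuantumAdvantage.DegreeOnePrimesEscapeWithoutProper` (the crux `DegreeOnePrimesEscape` with `M ≠ ⊤` deleted) is FALSE — a retired tombstone, never a hypothesis; its refutation is `Literature.Barriers.QuantumAdvantage.DegreeOnePrimesEscapeWithoutProper_false` (alias `not_degreeOnePrimesEscapeWithoutProper`, same statement with the negand explicit): name that theorem instead, or drop the reference; the intended statement is the route crux `Summit.QuantumAdvantage.QuantumAdvantage.Theses.LinnikCubicClassGroups.DegreeOnePrimesEscape` (WITH `M ≠ ⊤`)" (since := "2026-08-16")]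
def DegreeOnePrimesEscapeWithoutProper : Prop :=
  ∀ n : ℕ, ∃ C : ℕ, ∀ (K : Type) [Field K] [NumberField K], Module.finrank ℚ K = n →
    (∀ F : IntermediateField ℚ K, Module.finrank ℚ F ≠ 2) → ∀ x : ℕ,
      |NumberField.discr K| ^ C ≤ (x : ℤ) → ∀ M : Subgroup (ClassGroup (𝓞 K)),
        Nat.primeCounting x ≤ 8 * Set.ncard {P : Ideal (𝓞 K) | P.IsPrime ∧ (Ideal.absNorm P).Prime ∧
          Ideal.absNorm P ≤ x ∧ ∃ hP : P ∈ nonZeroDivisors (Ideal (𝓞 K)), ClassGroup.mk0 ⟨P, hP⟩ ∉ M}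

/-- The retired tombstone is equivalent to `False`: `iff_false_intro` of
`DegreeOnePrimesEscapeWithoutProper_false`. Since that theorem's statement is the explicit negand,
this also machine-checks that the tombstone's body IS the refuted statement (the two agree
definitionally, by unfolding). Deprecated together with the tombstone name it packages; use
`DegreeOnePrimesEscapeWithoutProper_false`. [folklore] -/
@[deprecated DegreeOnePrimesEscapeWithoutProper_false "the tombstone `DegreeOnePrimesEscapeWithoutProper` is retired (REFUTED); use `Literature.Barriers.QuantumAdvantage.DegreeOnePrimesEscapeWithoutProper_false`, whose statement is the explicit negand" (since := "2026-08-16")]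
theorem DegreeOnePrimesEscapeWithoutProper_iff_false : DegreeOnePrimesEscapeWithoutProper ↔ False :=
  iff_false_intro DegreeOnePrimesEscapeWithoutProper_false

end Literature.Barriers.QuantumAdvantage
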